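import Literature.MathematicalPhysics.QuantumFieldTheory.Balaban1983to89.B6Cover236MultiLevelTorusReach
import Literature.MathematicalPhysics.QuantumFieldTheory.Balaban1983to89.B6Partition118KLevelTorusWindow

/-!
# `Balaban1983to89.B6Cover236QbigOverlapV1` — T. Bałaban, *Propagators and renormalization transformations for lattice gauge theories. II*,
# Commun. Math. Phys. **96** (1984) 223–250 [Balaban1984PropagatorsII], (2.36) p. 229 / p. 235 / p. 239: THE FINITE OVERLAP OF THE CUT-OFF SETS
# `□̃ = QbigT □` OF THE k-LEVEL TORUS COVER — every torus block lies in at most `3·9^{d+1}` of the `□̃` (the overlap number `Nbig` of the outputs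
# of the (2.91) kernels; hypothesis (i) of `…B6Prop26KLevelAssemblyV1.prop26_2136_kLevel_assembly`, finding F5 (i) of the fold owner)

statement-level skeleton of published theorems with citation tags; proofs where landed; nothing here is a claim about the Yang–Mills mass gap

PDF held: `paper:balaban1984-cmp96-propagators-rt-ii` (journal page = PDF page + 222): p. 229 [PDF 7] ((2.36)), p. 235 [PDF 13] (*"a second cube □̃
containing □ in the middle"*), p. 239 [PDF 17] (*"ζ_□ ∈ C₀^∞(□̃)"*); read from the tree transcriptions in `…B6Cover236MultiLevelTorusReach` (p21 g17) and
`…B6Partition118KLevelFineLip`/`…TorusCentral`/`…TorusWindow` (p38).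

CITATION HEADER (lean-in-tree rule) — WHAT IS REPRODUCED.  Phase-2 file of the `lit-balaban` typed skeleton (HOME `run/shared/lean/pub/lit-balaban/`), unit
`lit-balaban-r03` (B6 fold owner; r03 gen 21, literature-prover-lit-balaban-r03-g21-0), referee ref-4.  SKELETON rows **B6.Eq2.36** × **B6.Prop2.6** ×
B6.Eq2.134 (cells; decls of record untouched).  THIS FILE is p21's `card_filter_mem_QT_le` (`□⁺`, radius `5S/4`, `3·5^{d+1}`) RE-RUN for p38's `QbigT`
(`□̃`, radius `7S/4`): the level window of a `□̃`-block comes from p38's `two_level_ball` (needs `(13/4)·L ≤ R`, implied by `R ≥ 2L²`), the label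
congruence from p21's `tshift_sub_ctrT`, and `|u − t| ≤ 13/4 ⇒ ⌊u⌋ − 4 ≤ t ≤ ⌊u⌋ + 4` gives `9` labels per coordinate.  IMPORTS BY NAME:
`B6Cover236MultiLevelTorusReach.abs_sub_le_of_blkOf_eq` (p21), `B6Cover236MultiLevelBlocks.proj/blkOf_proj/dist_proj_le/wit/blk_wit/dist_toR_ctr_le`
(p21), `B6Partition118KLevelFineLip.mem_Qbig` + `…TorusCentral.QbigT/σch/cc/Dch/cubesEquiv_cc/pow_le_half_bigSide` + `…TorusWindow.two_level_ball` (p38),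
`B6Partition118KLevelTorusChart.tshift_sub_ctrT/cubesEquiv_apply_val/label_mem_boxDom`, `B6Cover236MultiLevelTorusBlocks.rep/blkOf_rep/blkMap_fst`.

## WHAT THIS FILE CERTIFIES (kernel-checked, 0 sorry, standard axioms; THEOREMS ONLY — no `def`, no new fact)

* `window_and_congr_of_mem_QbigT` — a torus block `a ∈ QbigT □`, `□ = (j, β)`: `j − 1 ≤ j(a) ≤ j + 1` and `|x₀_μ − (β_μ + ½)S_j − N₀_μ·m| ≤ (13/4)S_j`
  for the representative site `x₀` of `a` and some integer `m`, every coordinate (`M_h ≥ 2`, `R ≥ 2L²`, `P_μ ≥ 4`).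
* **`card_filter_mem_QbigT_le`** — `#{□ : a ∈ QbigT □} ≤ 3·9^{d+1}` for every torus block `a`.

## HONEST SCOPE / DIVERGENCES

A counting lemma about the cover, not a printed inequality; the constant `3·9^{d+1}` is ours (print: «O(1)» overlaps).  `M_h ≥ 2`, `R ≥ 2L²` (for the
level window at radius `11S/4`), `P_μ ≥ 4` as in p38's torus partition files.  Integer torus; NOT summit progress.
-/

namespace Literature.MathematicalPhysics.QuantumFieldTheory.Balaban1983to89.B6Cover236QbigOverlapV1

open Finset
open Literature.MathematicalPhysics.QuantumFieldTheory.Balaban1983to89.B4Reflection242 (boxDom mem_boxDom blk)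
open Literature.MathematicalPhysics.QuantumFieldTheory.Balaban1983to89.B6MultiLevelBoxOperator (Domains N0 bigSide bigSide_eq
  one_le_bigSide)
open Literature.MathematicalPhysics.QuantumFieldTheory.Balaban1983to89.B6MultiLevelTorusOperator (TDomains tshift)
open Literature.MathematicalPhysics.QuantumFieldTheory.Balaban1983to89.B6Geom246MultiLevelBox (bset blkOf toR cen
  dist_toR_cen_le lev_eq_of_blkOf_eq)
open Literature.MathematicalPhysics.QuantumFieldTheory.Balaban1983to89.B6Geom246MultiLevelTorus (blkMap blkMap_blkOf)
open Literature.MathematicalPhysics.QuantumFieldTheory.Balaban1983to89.B6Cover236MultiLevelBlocks (cubes side side_eq side_pos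
  ctr proj blkOf_proj dist_proj_le wit blk_wit dist_toR_ctr_le)
open Literature.MathematicalPhysics.QuantumFieldTheory.Balaban1983to89.B6Partition118KLevelFineLip (Qbig mem_Qbig)
open Literature.MathematicalPhysics.QuantumFieldTheory.Balaban1983to89.B6Eq238MultiLevelBox (Pj one_le_Pj)
open Literature.MathematicalPhysics.QuantumFieldTheory.Balaban1983to89.B6Eq238MultiLevelTorus (svec qc N0_eq_mul_Pj)
open Literature.MathematicalPhysics.QuantumFieldTheory.Balaban1983to89.B6Partition118KLevelTorusChart (cT cubesEquiv
  cubesEquiv_apply_val tshift_sub_ctrT label_mem_boxDom)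
open Literature.MathematicalPhysics.QuantumFieldTheory.Balaban1983to89.B6Partition118KLevelTorusCentral (Dch σch cc side_cc
  cubesEquiv_cc QbigT level_bounds one_le_of_four_le pow_le_half_bigSide)
open Literature.MathematicalPhysics.QuantumFieldTheory.Balaban1983to89.B6Partition118KLevelTorusWindow (two_level_ball)
open Literature.MathematicalPhysics.QuantumFieldTheory.Balaban1983to89.B6Cover236MultiLevelTorusBlocks (rep blkOf_rep blkMap_fst)
open Literature.MathematicalPhysics.QuantumFieldTheory.Balaban1983to89.B6Cover236MultiLevelTorusReach (abs_sub_le_of_blkOf_eq)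

noncomputable section

variable {d : ℕ} {ℓ Mh k R : ℕ} {P : Fin (d + 1) → ℕ}

/-! ## §1 Arithmetic: an integer within `13/4` of a real lies in a window of `9` around its floor -/

/-- an integer `t` with `|u − t| ≤ 13/4` satisfies `⌊u⌋ − 4 ≤ t ≤ ⌊u⌋ + 4`. [folklore] -/
private theorem label_window9 {u : ℝ} {t : ℤ} (h : |u - (t : ℝ)| ≤ 13 / 4) : -4 ≤ t - ⌊u⌋ ∧ t - ⌊u⌋ ≤ 4 := by
  have h1 := Int.floor_le u
  have h2 := Int.lt_floor_add_one u
  rw [abs_le] at h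
  obtain ⟨hl, hr⟩ := h
  constructor
  · by_contra hlt
    have : (t : ℝ) + 5 ≤ (⌊u⌋ : ℝ) := by exact_mod_cast (show t + 5 ≤ ⌊u⌋ by omega)
    linarith
  · by_contra hlt
    have : (⌊u⌋ : ℝ) + 5 ≤ (t : ℝ) := by exact_mod_cast (show ⌊u⌋ + 5 ≤ t by omega)
    linarith

/-! ## §2 One cube: the level window and the label congruence of a cut-off set `□̃` containing a block -/

section Reach

variable (D : TDomains d ℓ Mh k P R)

/-- **A BLOCK OF `□̃` ON THE TORUS: THE LEVEL WINDOW AND THE LABEL CONGRUENCE.**  If the torus block `a` lies in the cut-off set `QbigT □` of the torus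
cube `□ = (j, β)`, then `j − 1 ≤ j(a) ≤ j + 1` (p38's `two_level_ball` at radius `11S/4`, `R ≥ 2L²`) and, for the representative site `x₀` of `a`, in
every coordinate `|x₀_μ − (β_μ + ½)S_j − N₀_μ·m| ≤ (13/4)S_j` for some integer `m` (the reach `7S/4` of `□̃` read on the torus through the canonical chart).
[cite: Balaban1984PropagatorsII, (2.36) p.229, p.235, p.239 («□̃»), dictionary (charts)] -/
theorem window_and_congr_of_mem_QbigT (hL : Odd (ℓ + 1) ∧ 1 < ℓ + 1) (hMh : 2 ≤ Mh) (hR2 : 2 * (ℓ + 1) ^ 2 ≤ R) (hMh1 : 1 ≤ Mh)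
    (hP4 : ∀ μ, 4 ≤ P μ) {c : ↥(cubes D.toDomains)} {a : ↥(bset D.toDomains)} (ha : a ∈ QbigT D hMh1 hP4 c) :
    (c.1.1 ≤ a.1.1 + 1 ∧ a.1.1 ≤ c.1.1 + 1) ∧
    ∀ μ : Fin (d + 1), ∃ m : ℤ, |((rep D.toDomains a).1 μ : ℝ) - ((c.1.2 μ : ℝ) + 1 / 2) * (bigSide ℓ Mh c.1.1 : ℝ) -
      (N0 ℓ Mh k P μ : ℝ) * m| ≤ 13 / 4 * (bigSide ℓ Mh c.1.1 : ℝ) := by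
  have hℓ : 1 ≤ ℓ := by have := hL.2; omega
  have hP : ∀ μ, 1 ≤ P μ := one_le_of_four_le hP4
  unfold QbigT at ha
  rw [Finset.mem_image] at ha
  obtain ⟨b, hb, hba⟩ := ha
  have hab : b.1.1 = a.1.1 := by rw [← hba]; exact (blkMap_fst D hMh1 hP c b).symm
  have hS : 0 < (bigSide ℓ Mh c.1.1 : ℝ) := Nat.cast_pos.2 (one_le_bigSide hMh1 _)
  -- a chart site of the chart block, within `11S/4` of the chart centre: the clamp of the cube's witness into the block
  obtain ⟨w, hwdef⟩ : ∃ w : ↥(boxDom (N0 ℓ Mh k P)), w = proj (Dch D c) b (wit (Dch D c) (cc D hMh1 hP4 c)).1 := ⟨_, rfl⟩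
  have hwb : blkOf (Dch D c) w = b := by rw [hwdef]; exact blkOf_proj (Dch D c) b _
  have hwctr : dist (toR w.1) (ctr (Dch D c) (cc D hMh1 hP4 c)) ≤ 11 / 4 * (bigSide ℓ Mh c.1.1 : ℝ) := by
    have h1 : dist (toR w.1) (toR (wit (Dch D c) (cc D hMh1 hP4 c)).1) ≤ dist (cen (Dch D c) b) (toR (wit (Dch D c) (cc D hMh1 hP4 c)).1) := by
      rw [hwdef]; exact dist_proj_le (Dch D c) b _
    have h2 : dist (cen (Dch D c) b) (ctr (Dch D c) (cc D hMh1 hP4 c)) ≤ 7 / 4 * (bigSide ℓ Mh c.1.1 : ℝ) := (mem_Qbig (Dch D c)).1 hb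
    have h3 : dist (toR (wit (Dch D c) (cc D hMh1 hP4 c)).1) (ctr (Dch D c) (cc D hMh1 hP4 c)) ≤ (bigSide ℓ Mh c.1.1 : ℝ) / 2 :=
      dist_toR_ctr_le (Dch D c) hMh1 (blk_wit (Dch D c) (cc D hMh1 hP4 c))
    have t1 := dist_triangle (toR w.1) (toR (wit (Dch D c) (cc D hMh1 hP4 c)).1) (ctr (Dch D c) (cc D hMh1 hP4 c))
    have t2 := dist_triangle (cen (Dch D c) b) (ctr (Dch D c) (cc D hMh1 hP4 c)) (toR (wit (Dch D c) (cc D hMh1 hP4 c)).1)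
    rw [dist_comm (ctr (Dch D c) (cc D hMh1 hP4 c))] at t2
    linarith
  -- the level window: p38's two-level ball of radius `11S/4` (`(11/4 + 1/2)·L ≤ 2L² ≤ R`)
  have hρ : (11 / 4 * (bigSide ℓ Mh c.1.1 : ℝ) + (bigSide ℓ Mh c.1.1 : ℝ) / 2) * ((ℓ : ℝ) + 1) ≤ (R : ℝ) * (bigSide ℓ Mh c.1.1 : ℝ) := by
    have hRr : (2 : ℝ) * ((ℓ : ℝ) + 1) ^ 2 ≤ R := by exact_mod_cast hR2
    have hl : (1 : ℝ) ≤ ℓ := by exact_mod_cast hℓ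
    have h1 : (13 / 4 : ℝ) * ((ℓ : ℝ) + 1) ≤ R := by nlinarith
    have e : (11 / 4 * (bigSide ℓ Mh c.1.1 : ℝ) + (bigSide ℓ Mh c.1.1 : ℝ) / 2) * ((ℓ : ℝ) + 1) =
        (13 / 4 * ((ℓ : ℝ) + 1)) * (bigSide ℓ Mh c.1.1 : ℝ) := by ring
    rw [e]
    exact mul_le_mul_of_nonneg_right h1 hS.le
  obtain ⟨j₀, hj₀, hball⟩ := two_level_ball (D := D) hℓ hMh1 hP4 c hρ
  have hlev := hball w hwctr
  have hlw : (Dch D c).lev w.1 = a.1.1 := by rw [← hab]; exact lev_eq_of_blkOf_eq (Dch D c) hwb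
  rw [hlw] at hlev
  have hw : c.1.1 ≤ a.1.1 + 1 ∧ a.1.1 ≤ c.1.1 + 1 := by rcases hj₀ with h | h <;> omega
  refine ⟨hw, fun μ => ?_⟩
  have hwc : |(w.1 μ : ℝ) - ctr (Dch D c) (cc D hMh1 hP4 c) μ| ≤ 11 / 4 * (bigSide ℓ Mh c.1.1 : ℝ) := by
    have hμ : dist (toR w.1 μ) (ctr (Dch D c) (cc D hMh1 hP4 c) μ) ≤ dist (toR w.1) (ctr (Dch D c) (cc D hMh1 hP4 c)) :=
      dist_le_pi_dist _ _ μ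
    have e : dist (toR w.1 μ) (ctr (Dch D c) (cc D hMh1 hP4 c) μ) = |(w.1 μ : ℝ) - ctr (Dch D c) (cc D hMh1 hP4 c) μ| :=
      Real.dist_eq _ _
    rw [← e]
    linarith
  -- the congruence «torus site − torus centre ≡ chart site − chart centre (mod N₀)»
  have hjk : (cc D hMh1 hP4 c).1.1 ≤ k := (level_bounds D.toDomains c).2
  obtain ⟨m, hm⟩ := tshift_sub_ctrT (svec ℓ k c.1.1 c.1.2) (c := (cc D hMh1 hP4 c).1) hjk w μ
  have hcT : cT ℓ k P (svec ℓ k c.1.1 c.1.2) (cc D hMh1 hP4 c).1 = c.1 := by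
    have h := congrArg Subtype.val (cubesEquiv_cc (D := D) hMh1 hP4 c)
    rwa [cubesEquiv_apply_val] at h
  rw [hcT] at hm
  have ectr : ctr (Dch D c) (cc D hMh1 hP4 c) μ = (((cc D hMh1 hP4 c).1.2 μ : ℝ) + 1 / 2) * (bigSide ℓ Mh c.1.1 : ℝ) := rfl
  rw [ectr] at hwc
  -- the torus site `x = σ_c w` lies in the block `a`
  obtain ⟨x, hxdef⟩ : ∃ x : ↥(boxDom (N0 ℓ Mh k P)), x = σch D c w := ⟨_, rfl⟩
  have hxa : blkOf D.toDomains x = a := by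
    rw [hxdef, ← hba, ← hwb]
    exact (blkMap_blkOf hMh1 hP (svec ℓ k c.1.1 c.1.2) w).symm
  have hm' : (x.1 μ : ℝ) - ((c.1.2 μ : ℝ) + 1 / 2) * (bigSide ℓ Mh c.1.1 : ℝ) =
      ((w.1 μ : ℝ) - (((cc D hMh1 hP4 c).1.2 μ : ℝ) + 1 / 2) * (bigSide ℓ Mh c.1.1 : ℝ)) + (N0 ℓ Mh k P μ : ℝ) * m := by
    rw [hxdef]; exact hm
  -- two sites of `a` differ by less than `L^{j(a)} ≤ S/2`
  have hxx : |(x.1 μ : ℝ) - ((rep D.toDomains a).1 μ : ℝ)| ≤ (((ℓ + 1) ^ a.1.1 : ℕ) : ℝ) - 1 :=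
    abs_sub_le_of_blkOf_eq D.toDomains hxa (blkOf_rep D.toDomains a) μ
  have h4 : (((ℓ + 1) ^ a.1.1 : ℕ) : ℝ) ≤ (bigSide ℓ Mh c.1.1 : ℝ) / 2 := pow_le_half_bigSide (ℓ := ℓ) hMh hw.2
  refine ⟨m, ?_⟩
  rw [abs_le] at hwc hxx ⊢
  obtain ⟨hwc1, hwc2⟩ := hwc
  obtain ⟨hxx1, hxx2⟩ := hxx
  constructor <;> linarith

end Reach

/-! ## §3 The count: at most `3·9^{d+1}` cut-off sets contain a given torus block -/

section Count

variable (D : TDomains d ℓ Mh k P R)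

/-- **FINITE OVERLAP OF THE CUT-OFF SETS `□̃` ON THE TORUS** (the binder `Nbig` of `…B6Prop26KLevelAssemblyV1.prop26_2136_kLevel_assembly` with
`Nbig = 3·9^{d+1}`): every torus block lies in at most `3·9^{d+1}` of the sets `QbigT □` (three levels, nine labels per coordinate).
[cite: Balaban1984PropagatorsII, (2.36) p.229 («each cube being a sum of 2^d big blocks»), p.235, p.239, bookkeeping] -/
theorem card_filter_mem_QbigT_le (hL : Odd (ℓ + 1) ∧ 1 < ℓ + 1) (hMh : 2 ≤ Mh) (hR2 : 2 * (ℓ + 1) ^ 2 ≤ R) (hMh1 : 1 ≤ Mh) (hP4 : ∀ μ, 4 ≤ P μ)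
    (a : ↥(bset D.toDomains)) :
    #(Finset.univ.filter fun c : ↥(cubes D.toDomains) => a ∈ QbigT D hMh1 hP4 c) ≤ 3 * 9 ^ (d + 1) := by
  classical
  have hP : ∀ μ, 1 ≤ P μ := one_le_of_four_le hP4
  obtain ⟨x₀, hx₀⟩ : ∃ x₀ : ↥(boxDom (N0 ℓ Mh k P)), x₀ = rep D.toDomains a := ⟨_, rfl⟩
  obtain ⟨u, hu⟩ : ∃ u : ℕ → Fin (d + 1) → ℤ,
      u = fun j μ => ⌊(x₀.1 μ : ℝ) / (bigSide ℓ Mh j : ℝ) - 1 / 2⌋ := ⟨_, rfl⟩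
  obtain ⟨T, hT⟩ : ∃ T : Finset (ℕ × (Fin (d + 1) → ℤ)), T = (Finset.Icc (a.1.1 - 1) (a.1.1 + 1)).biUnion
      fun j => (Fintype.piFinset fun _ : Fin (d + 1) => Finset.Icc (-4 : ℤ) 4).image
        fun e => (j, fun μ => (u j μ + e μ) % (Pj ℓ k P j μ : ℤ)) := ⟨_, rfl⟩
  have h9 : #(Finset.Icc (-4 : ℤ) 4) = 9 := by rw [Int.card_Icc]; rfl
  have hT3 : #T ≤ 3 * 9 ^ (d + 1) := by
    rw [hT]
    refine Finset.card_biUnion_le.trans ?_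
    calc ∑ j ∈ Finset.Icc (a.1.1 - 1) (a.1.1 + 1),
          #((Fintype.piFinset fun _ : Fin (d + 1) => Finset.Icc (-4 : ℤ) 4).image
            fun e => (j, fun μ => (u j μ + e μ) % (Pj ℓ k P j μ : ℤ)))
        ≤ ∑ _j ∈ Finset.Icc (a.1.1 - 1) (a.1.1 + 1), 9 ^ (d + 1) := Finset.sum_le_sum fun j _ => by
          refine Finset.card_image_le.trans (le_of_eq ?_)
          rw [Fintype.card_piFinset_const, h9]
      _ = #(Finset.Icc (a.1.1 - 1) (a.1.1 + 1)) * 9 ^ (d + 1) := by rw [Finset.sum_const, smul_eq_mul]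
      _ ≤ 3 * 9 ^ (d + 1) := by rw [Nat.card_Icc]; exact Nat.mul_le_mul_right _ (by omega)
  have hsub : (Finset.univ.filter fun c : ↥(cubes D.toDomains) => a ∈ QbigT D hMh1 hP4 c).map
      ⟨Subtype.val, Subtype.val_injective⟩ ⊆ T := by
    intro cv hc
    rw [Finset.mem_map] at hc
    obtain ⟨c, hc, rfl⟩ := hc
    have ha := (Finset.mem_filter.1 hc).2
    obtain ⟨hwin, hcong⟩ := window_and_congr_of_mem_QbigT D hL hMh hR2 hMh1 hP4 ha
    choose m hm using hcong
    have hjk : c.1.1 ≤ k := (level_bounds D.toDomains c).2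
    have hS : 0 < (bigSide ℓ Mh c.1.1 : ℝ) := Nat.cast_pos.2 (one_le_bigSide hMh1 _)
    have hlab := mem_boxDom.1 (label_mem_boxDom D.toDomains hMh1 c.2)
    have hN : ∀ μ, (N0 ℓ Mh k P μ : ℝ) = (bigSide ℓ Mh c.1.1 : ℝ) * (Pj ℓ k P c.1.1 μ : ℝ) := fun μ => by
      rw [N0_eq_mul_Pj hjk μ, bigSide_eq]; push_cast; ring
    -- per coordinate: the label is `⌊x₀_μ/S − ½⌋ + e (mod P_j)` with `|e| ≤ 4`
    have hwin' : ∀ μ, -4 ≤ c.1.2 μ + (Pj ℓ k P c.1.1 μ : ℤ) * m μ - u c.1.1 μ ∧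
        c.1.2 μ + (Pj ℓ k P c.1.1 μ : ℤ) * m μ - u c.1.1 μ ≤ 4 := by
      intro μ
      rw [hu]
      refine label_window9 ?_
      have h := hm μ
      rw [← hx₀, hN μ] at h
      have e : (x₀.1 μ : ℝ) / (bigSide ℓ Mh c.1.1 : ℝ) - 1 / 2 - ((c.1.2 μ + (Pj ℓ k P c.1.1 μ : ℤ) * m μ : ℤ) : ℝ) =
          ((x₀.1 μ : ℝ) - ((c.1.2 μ : ℝ) + 1 / 2) * (bigSide ℓ Mh c.1.1 : ℝ) -
            (bigSide ℓ Mh c.1.1 : ℝ) * (Pj ℓ k P c.1.1 μ : ℝ) * (m μ)) / (bigSide ℓ Mh c.1.1 : ℝ) := by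
        push_cast; field_simp; ring
      rw [e, abs_div, abs_of_pos hS, div_le_iff₀ hS]
      linarith
    rw [hT, Finset.mem_biUnion]
    refine ⟨c.1.1, by rw [Finset.mem_Icc]; omega, ?_⟩
    rw [Finset.mem_image]
    refine ⟨fun μ => c.1.2 μ + (Pj ℓ k P c.1.1 μ : ℤ) * m μ - u c.1.1 μ, ?_, ?_⟩
    · rw [Fintype.mem_piFinset]; intro μ; rw [Finset.mem_Icc]; exact hwin' μ
    · show (c.1.1, fun μ => (u c.1.1 μ + (c.1.2 μ + (Pj ℓ k P c.1.1 μ : ℤ) * m μ - u c.1.1 μ)) % (Pj ℓ k P c.1.1 μ : ℤ))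
        = c.1
      refine Prod.ext rfl (funext fun μ => ?_)
      show (u c.1.1 μ + (c.1.2 μ + (Pj ℓ k P c.1.1 μ : ℤ) * m μ - u c.1.1 μ)) % (Pj ℓ k P c.1.1 μ : ℤ) = c.1.2 μ
      have e : u c.1.1 μ + (c.1.2 μ + (Pj ℓ k P c.1.1 μ : ℤ) * m μ - u c.1.1 μ) =
          c.1.2 μ + (Pj ℓ k P c.1.1 μ : ℤ) * m μ := by ring
      rw [e, Int.add_mul_emod_self_left]
      exact Int.emod_eq_of_lt (hlab μ).1 (hlab μ).2
  calc #(Finset.univ.filter fun c : ↥(cubes D.toDomains) => a ∈ QbigT D hMh1 hP4 c)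
      = #((Finset.univ.filter fun c : ↥(cubes D.toDomains) => a ∈ QbigT D hMh1 hP4 c).map
          ⟨Subtype.val, Subtype.val_injective⟩) := (Finset.card_map _).symm
    _ ≤ #T := Finset.card_le_card hsub
    _ ≤ 3 * 9 ^ (d + 1) := hT3

end Count

end

end Literature.MathematicalPhysics.QuantumFieldTheory.Balaban1983to89.B6Cover236QbigOverlapV1
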